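/-
Copyright (c) 2026 the pub-hodgecm-mathlib formalisation cell (harness21).  Prover seat hodgecm-mathlib-K2E5-p16 (g9) (chair K2-lead (g2) VALVE 24 (bb) → S10 dealer R90-C138-plan (g3)
RE-DEAL #61′, RULING J-LC′, conductor R90-C138-p06 (g0), 2026-09-05): R90-TF · S10 (Rogawski 1990 §13.8) · THE PAYER OF THE RESIDUAL LETTER L-C′ `TorusCharExtend`.
-/
import Literature.NumberTheory.Automorphic.Arthur2013.Leaves.TorusLocalDatum              -- ★ §45.16 `TorusDict.exists_isAutomorphic_of_localData` (Weil's principle with prescribed components), ★ `TorusDict.cpt`; brings ★ TorusDictionary §45.11–§45.13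
import Literature.NumberTheory.Automorphic.TorusCharacterLocalComponents                -- ★ `torusLocalComponent`, `locTorusIncl`, `semilocalUnits`, `HeckeCharacter.semilocalComponent`, `cm_pullback_semilocalComponent`
import Literature.NumberTheory.Automorphic.UnitaryGroupNonsplitPlace                     -- ★ `PlacesOver.subsingleton_of_smul_eq`, `PlacesOver.prod_eq_of_smul_eq`
import Literature.NumberTheory.Automorphic.BaseChangeStrongAllFiniteRamifiedPlaces        -- ★ `HeightOneSpectrum.eq_of_under_eq_of_not_isUnramifiedIn` (one place above a ramified prime)
import Literature.NumberTheory.Automorphic.GaloisActionPlaces                            -- ★ `HeightOneSpectrum.under_algEquiv_smul`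
import Summits.HodgeConjecture.HodgeConjecture.Theorems.F0P2oStubDictTorusChar            -- ★ `exists_quotConj_eq_of_nonsplit` (local Hilbert 90 at a non-split place)
import Summits.HodgeConjecture.HodgeConjecture.Theorems.F0P3cStCharTSPrincipalSeriesUnitary -- ★ `norm_apply_normOneUnits_eq_one` (a continuous character of the compact local torus at a non-split place is unitary)
import Literature.NumberTheory.Automorphic.LocalNormOneHilbert90                       -- ★ `map_adeleToLocal_smul`, `map_adeleToLocal_semilocalUnits` (the `v`-block of idèles)
import HarnessLib

/-!
# R90-TF · S10 (Rogawski 1990 §13.8) · THEOREMS — `R90S10TorusCharExtend`: A CHARACTER OF THE COMPACT LOCAL TORUS `T(L⁺_v)` (`v` NON-SPLIT) IS THE `v`-COMPONENT OF AN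
# AUTOMORPHIC CHARACTER OF `T(𝔸_{L⁺})` THAT IS SPHERICAL AT EVERY FINITE `w ≠ v` (the residual letter L-C′ `TorusCharExtend` of `sock_S10_realiseH₂`, PAID)

Cell hodgecm-mathlib, slab R90-TF, section S10 = §13.8, crux item h413 = `stmt-HodgeConjecture-24833` (route `route-HodgeConjecture-HCCMUnconditional`).
Prover seat K2E5-p16 (g9); RE-DEAL #61′ of the S10 dealer R90-C138-plan (g3) under RULING J-LC′ (census R90-C138-p06 (g0) 02:50:40Z: «a character `ψ_v` of the
COMPACT local torus `T(L⁺_v) = U(1)(L⁺_v)`, `v` NON-SPLIT, is the `v`-component of an AUTOMORPHIC character of `T(𝔸_{L⁺})` that is TRIVIAL on `T(𝒪_w)` for every finite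
`w ≠ v`» — TRUE; the off-`v` control is the whole difficulty).  THEOREMS ONLY (no `def`, no `instance`, no `notation`, no named-fact hypothesis, no `sorry`); lane
`--supports stmt-HodgeConjecture-24833 --as helper`.

PRINT [Rogawski1990, §13.8 p. 217 l. 9–12]: « every character of `∏′ 𝒪_v^1` extends to a character of `E^1 \ E^1_𝔸` … with `φ_w = φ′` » — Weil's extension principle on
`T_∞ · T(L⁺_v) · ∏_{w ≠ v} T(𝒪_w)` modulo `T(L⁺) ∩ (T_∞ · ∏_w T(𝒪_w)) = μ(L)` (Kronecker), the archimedean exponents compensating `ψ_v` on `μ(L)` ([Arthur2013, §6.2]).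
THE ROAD (census K2E5-p16 (g9) 02:56Z: the Weil re-run IS ★): Lit. `Arthur2013/Leaves/TorusLocalDatum.lean` §45.16 ★ `TorusDict.exists_isAutomorphic_of_localData` (prescribed
unitary data `π_u` on a finite set `V` of `c`-FIXED places, exponents `e`, joint condition `H` on `μ(L)` ⇒ automorphic `ψ` with those components, type `(2e, 0)`, spherical at the
UNRAMIFIED places not below `V`).  We take `V :=` the places over `{v} ∪ Ram(L∕L⁺)` (all `c`-fixed, ★ `HeightOneSpectrum.eq_of_under_eq_of_not_isUnramifiedIn`) and the data
`π_u := θ ∘ (·)_v ∘ ⟨·⟩_u`, `θ := (χT ∘ quotConj)⁻¹` (`(·)_v` = the units of ★ `adeleToLocal L v`, `⟨·⟩_u` = ★ `localUnits u`), so that `π_u = 1` AUTOMATICALLY off `v`: this kills the sign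
left by §45.13 at the RAMIFIED `w ≠ v` (cell DIVERGENCE D-TY-219) — there `χ̃_u = 1` on ALL of `L_uˣ`, hence `ψ_w ≡ 1` on `T(L⁺_w)` by local Hilbert 90 (★ `exists_quotConj_eq_of_nonsplit`,
★ `cm_pullback_semilocalComponent`); `H` becomes the COMPENSATION `χT((ζ)_v) = ∏_w ι_w(ζ)^{e_w}` on `μ(L)` (binder `hζ`; producer: R90-C138-p06's B3 `exists_archExponents_compensating`);
`χT` is unitary because `T(L⁺_v)` is compact (★ `norm_apply_normOneUnits_eq_one`).

CONTENTS.
* §1 idèle bookkeeping at `v` (the units `(·)_v` of ★ `adeleToLocal`, their interaction with ★ `localUnits`, ★ `semilocalUnits`, the Galois twist and the torus);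
* §2 continuity into `ℂˣ`; the places over a ramified place are `c`-fixed;
* §3 the joint condition from the compensation `hζ`;
* §4 **`exists_isAutomorphic_torusLocalComponent_eq_spherical_off_of_exponents`** — for `v` non-split, `χT : T(L⁺_v) →* ℂˣ` continuous and exponents `e` compensating `χT` on `μ(L)`:
  `∃ ψ` automorphic, `torusLocalComponent v ψ = χT`, `ψ` trivial on `T(𝒪_w)` (★ `localUnitIdeles L⁺ L w`) for EVERY finite `w ≠ v`, and `χ̃` of type `(2e, 0)`.

HONEST LABEL: pays no socket by itself (it is the payer of the residual letter L-C′ of `sock_S10_realiseH₂`'s block C modulo the compensation exponents `e`, R90-C138-p06's B3);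
HC_CM is proved only modulo the 7 printed citations (2 remaining named inputs: hLiu418 = `stmt-HodgeConjecture-24832`, h413 = `stmt-HodgeConjecture-24833`) until rung 0 closes;
count-neutral helper; REL ≠ ★ ≠ BUILT.  Namespace `Summit.HodgeConjecture.HodgeConjecture.R90.S10`.

## References
* [Rogawski1990] J. D. Rogawski, *Automorphic Representations of Unitary Groups in Three Variables*, Ann. of Math. Stud. 123 (1990): §13.8 p. 217 l. 9–12, p. 218 L9–10 (ii).
* [Arthur2013] J. Arthur, *The Endoscopic Classification of Representations*, AMS Colloquium Publ. 61 (2013): §6.2, Lemma 6.2.2 (i)(ii) and Remarks 2–3 (the globalising torus).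
* [Weil1956] A. Weil, *On a certain type of characters of the idèle-class group of an algebraic number-field*, Tokyo–Nikko 1955 (1956), §1 (the extension principle).
* [CasselsFrohlichANT1967] J. W. S. Cassels, A. Fröhlich (eds.), *Algebraic Number Theory* (1967), Ch. V §2.7 (Hilbert 90), Ch. VII §7.4.
-/

set_option autoImplicit false
-- the mandated namespace repeats the single-problem summit's segment (`HodgeConjecture.HodgeConjecture`)
set_option linter.dupNamespace false

noncomputable section

open NumberField IsDedekindDomain
open scoped Topology
open Literature.NumberTheory Literature.NumberTheory.Automorphic Literature.NumberTheory.Automorphic.UnitaryGroup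
open Literature.NumberTheory.GaloisRepresentations
open Literature.NumberTheory.Automorphic.Arthur2013.Leaves.TECR
open Summit.HodgeConjecture.HodgeConjecture.Cruxes.H413.F0P2oStubDictTorusChar (exists_quotConj_eq_of_nonsplit)

namespace Summit.HodgeConjecture.HodgeConjecture.R90.S10

variable (L : Type) [Field L] [NumberField L] [IsCMField L]

/-! ## §1 Idèle bookkeeping at a finite place `v` of `L⁺`: the units `(·)_v` of `adeleToLocal` -/

section Bookkeeping

variable {v : HeightOneSpectrum (𝓞 ↥(maximalRealSubfield L))}

omit [IsCMField L] in
/-- a local idèle at a place NOT over `v` has trivial `v`-block. [cite: CasselsFrohlichANT1967, Ch. II §10–§11] -/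
theorem unitsMap_adeleToLocal_localUnits_of_under_ne {u : HeightOneSpectrum (𝓞 L)} (hu : u.under (𝓞 ↥(maximalRealSubfield L)) ≠ v) (x : (u.adicCompletion L)ˣ) :
    Units.map (adeleToLocal L v : AdeleRing (𝓞 L) L →+* LocalRing L v).toMonoidHom (localUnits u x) = 1 := by
  refine Units.ext (funext fun w => ?_)
  have hwu : w.1 ≠ u := fun h => hu (h ▸ w.2)
  change ((localUnits u x : ideleGroup L) : AdeleRing (𝓞 L) L).2 w.1 = 1
  exact localUnits_snd_apply_of_ne x hwu

omit [IsCMField L] in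
/-- the `v`-block of the local idèle `⟨x⟩_w` at a place `w ∣ v` has `w`-coordinate `x`. [cite: CasselsFrohlichANT1967, Ch. II §10–§11] -/
theorem piUnits_unitsMap_adeleToLocal_localUnits (w : PlacesOver L v) (x : (w.1.adicCompletion L)ˣ) :
    MulEquiv.piUnits (Units.map (adeleToLocal L v : AdeleRing (𝓞 L) L →+* LocalRing L v).toMonoidHom (localUnits w.1 x)) w = x := by
  refine Units.ext ?_
  change ((localUnits w.1 x : ideleGroup L) : AdeleRing (𝓞 L) L).2 w.1 = x
  exact localUnits_snd_apply_self _ _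

/-- at a NON-SPLIT `v` (one place `w ∣ v`), the `v`-block of `⟨·⟩_w` followed by the block inclusion is `⟨·⟩_w` again: `semilocalUnits v ((⟨x⟩_w)_v) = ⟨x⟩_w`.
[cite: CasselsFrohlichANT1967, Ch. VII Prop. 1.2 (ii)] -/
theorem semilocalUnits_unitsMap_adeleToLocal_localUnits (w : PlacesOver L v) (hw : IsCMField.complexConj L • w.1 = w.1) (x : (w.1.adicCompletion L)ˣ) :
    semilocalUnits L v (Units.map (adeleToLocal L v : AdeleRing (𝓞 L) L →+* LocalRing L v).toMonoidHom (localUnits w.1 x)) = localUnits w.1 x := by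
  haveI := PlacesOver.subsingleton_of_smul_eq (IsCMField.complexConj L) (IsCMField.complexConj_ne_one (K := L)) w hw
  rw [semilocalUnits_apply, PlacesOver.prod_eq_of_smul_eq (IsCMField.complexConj L) (IsCMField.complexConj_ne_one (K := L)) w hw,
    piUnits_unitsMap_adeleToLocal_localUnits]

omit [IsCMField L] in
/-- an idèle supported above `v` (archimedean part `1`, finite components `1` off the places over `v`) is the block inclusion of its `v`-block.
[cite: TateThesis1967, §3.2] -/
theorem semilocalUnits_unitsMap_adeleToLocal_of_supported {y : ideleGroup L} (h1 : ((y : ideleGroup L) : AdeleRing (𝓞 L) L).1 = 1)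
    (hsupp : ∀ q : HeightOneSpectrum (𝓞 L), q.under (𝓞 ↥(maximalRealSubfield L)) ≠ v → ((y : ideleGroup L) : AdeleRing (𝓞 L) L).2 q = 1) :
    semilocalUnits L v (Units.map (adeleToLocal L v : AdeleRing (𝓞 L) L →+* LocalRing L v).toMonoidHom y) = y := by
  refine Units.ext (Prod.ext ?_ (FiniteAdeleRing.ext L fun q => ?_))
  · rw [semilocalUnits_fst, h1]
  · by_cases hq : q.under (𝓞 ↥(maximalRealSubfield L)) = v
    · rw [semilocalUnits_snd_apply_of_over L _ ⟨q, hq⟩]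
      rfl
    · rw [semilocalUnits_snd_apply_of_not_over L _ hq, hsupp q hq]

/-- the `v`-block of a torus idèle is a norm-one unit of `L ⊗ L⁺_v`. [cite: PlatonovRapinchuk1994, §6.2] -/
theorem unitsMap_adeleToLocal_mem_normOneUnits {t : ideleGroup L} (ht : t ∈ TorusDict.torus (IsCMField.complexConj L)) :
    Units.map (adeleToLocal L v : AdeleRing (𝓞 L) L →+* LocalRing L v).toMonoidHom t ∈ normOneUnits (conjLocal L (IsCMField.complexConj L) v) := by
  rw [mem_normOneUnits_iff]
  have h := congrArg (fun x : ideleGroup L => ((Units.map (adeleToLocal L v : AdeleRing (𝓞 L) L →+* LocalRing L v).toMonoidHom x : (LocalRing L v)ˣ) : LocalRing L v))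
    ((TorusDict.mem_torus_iff (IsCMField.complexConj L)).1 ht)
  simp only [map_mul, map_one, Units.val_mul, Units.val_one, map_adeleToLocal_smul L (IsCMField.complexConj L)] at h
  rw [mul_comm] at h
  exact h

/-- the `v`-block of ★ `locTorusIncl v β` is `β`. [cite: PlatonovRapinchuk1994, §6.2] -/
theorem unitsMap_adeleToLocal_locTorusIncl (β : ↥(normOneUnits (conjLocal L (IsCMField.complexConj L) v))) :
    Units.map (adeleToLocal L v : AdeleRing (𝓞 L) L →+* LocalRing L v).toMonoidHom
        ((locTorusIncl L (IsCMField.complexConj L) v β : ↥(TorusDict.torus (IsCMField.complexConj L))) : ideleGroup L) = (β : (LocalRing L v)ˣ) := by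
  rw [coe_locTorusIncl, map_adeleToLocal_semilocalUnits]

omit [IsCMField L] in
/-- the `v`-block is continuous on idèles. [folklore] -/
theorem continuous_unitsMap_adeleToLocal :
    Continuous (Units.map (adeleToLocal L v : AdeleRing (𝓞 L) L →+* LocalRing L v).toMonoidHom : ideleGroup L → (LocalRing L v)ˣ) :=
  Continuous.units_map _ (continuous_adeleToLocal L v)

/-- at a NON-SPLIT `v` (`w ∣ v` fixed by `c`), the `v`-block of an idèle only sees its `w`-coordinate: `((⟨y_w⟩_w)_v) = y_v` (★ `TorusDict.cpt`).
[cite: CasselsFrohlichANT1967, Ch. VII Prop. 1.2 (ii)] -/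
theorem unitsMap_adeleToLocal_localUnits_cpt (w : PlacesOver L v) (hw : IsCMField.complexConj L • w.1 = w.1) (y : ideleGroup L) :
    Units.map (adeleToLocal L v : AdeleRing (𝓞 L) L →+* LocalRing L v).toMonoidHom (localUnits w.1 (TorusDict.cpt w.1 y)) =
      Units.map (adeleToLocal L v : AdeleRing (𝓞 L) L →+* LocalRing L v).toMonoidHom y := by
  haveI := PlacesOver.subsingleton_of_smul_eq (IsCMField.complexConj L) (IsCMField.complexConj_ne_one (K := L)) w hw
  refine Units.ext (funext fun w' => ?_)
  obtain rfl : w' = w := Subsingleton.elim _ _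
  change ((localUnits w'.1 (TorusDict.cpt w'.1 y) : ideleGroup L) : AdeleRing (𝓞 L) L).2 w'.1 = ((y : ideleGroup L) : AdeleRing (𝓞 L) L).2 w'.1
  rw [localUnits_snd_apply_self]
  rfl

/-- the `v`-block of a base-changed idèle `(a)_L`, `a ∈ 𝕀_{L⁺}`, is fixed by `c ⊗ 1` (★ `AdeleRing.smul_ideleBaseChange`). [cite: CasselsFrohlichANT1967, Ch. VII §1.1] -/
theorem unitsMap_conjLocal_unitsMap_adeleToLocal_ideleBaseChange (a : ideleGroup ↥(maximalRealSubfield L)) :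
    Units.map (conjLocal L (IsCMField.complexConj L) v : LocalRing L v →+* LocalRing L v).toMonoidHom
        (Units.map (adeleToLocal L v : AdeleRing (𝓞 L) L →+* LocalRing L v).toMonoidHom (AdeleRing.ideleBaseChange ↥(maximalRealSubfield L) L a)) =
      Units.map (adeleToLocal L v : AdeleRing (𝓞 L) L →+* LocalRing L v).toMonoidHom (AdeleRing.ideleBaseChange ↥(maximalRealSubfield L) L a) := by
  rw [← map_adeleToLocal_smul L (IsCMField.complexConj L), AdeleRing.smul_ideleBaseChange]

/-- `quotConj` of a `(c ⊗ 1)`-fixed unit is `1`. [cite: Rogawski1990, §12.1 p. 172] -/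
theorem quotConj_eq_one_of_fixed {x : (LocalRing L v)ˣ}
    (hx : Units.map (conjLocal L (IsCMField.complexConj L) v : LocalRing L v →+* LocalRing L v).toMonoidHom x = x) :
    quotConj (conjLocal L (IsCMField.complexConj L) v) (conjLocal_conjLocal_cm L v) x = 1 := by
  refine Subtype.ext ?_
  rw [coe_quotConj]
  change x * (Units.map (conjLocal L (IsCMField.complexConj L) v : LocalRing L v →+* LocalRing L v).toMonoidHom x)⁻¹ = 1
  rw [hx, mul_inv_cancel]

include L in
/-- `quotConj` of the `v`-block of a principal idèle `(k)` is the `v`-block of the principal idèle `(k ∕ c k)` (★ `smul_principalIdele`). [cite: Rogawski1990, §12.1 p. 172] -/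
theorem coe_quotConj_unitsMap_adeleToLocal_principalIdele (k : Lˣ) :
    ((quotConj (conjLocal L (IsCMField.complexConj L) v) (conjLocal_conjLocal_cm L v)
        (Units.map (adeleToLocal L v : AdeleRing (𝓞 L) L →+* LocalRing L v).toMonoidHom (GaloisRepresentations.principalIdele L k)) :
          ↥(normOneUnits (conjLocal L (IsCMField.complexConj L) v))) : (LocalRing L v)ˣ) =
      Units.map (adeleToLocal L v : AdeleRing (𝓞 L) L →+* LocalRing L v).toMonoidHom
        (GaloisRepresentations.principalIdele L (k * (Units.map ((IsCMField.complexConj L : L ≃ₐ[↥(maximalRealSubfield L)] L) : L →+* L).toMonoidHom k)⁻¹)) := by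
  rw [coe_quotConj]
  change _ * (Units.map (conjLocal L (IsCMField.complexConj L) v : LocalRing L v →+* LocalRing L v).toMonoidHom _)⁻¹ = _
  rw [← map_adeleToLocal_smul L (IsCMField.complexConj L), HeckeCharacter.CMQuadraticExtension.smul_principalIdele, ← map_inv, ← map_mul, ← map_inv, ← map_mul]

/-- a torus idèle in the level `T(𝒪_w)` (★ `localUnitIdeles L⁺ L w`: supported above `w`, unit components) IS the local torus element `locTorusIncl w (t_w)`.
[cite: PlatonovRapinchuk1994, §6.2] -/
theorem eq_locTorusIncl_of_mem_localUnitIdeles {t : ↥(TorusDict.torus (IsCMField.complexConj L))}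
    (ht : (t : ideleGroup L) ∈ IdeleHerbrand.localUnitIdeles ↥(maximalRealSubfield L) L v) :
    t = locTorusIncl L (IsCMField.complexConj L) v
      ⟨Units.map (adeleToLocal L v : AdeleRing (𝓞 L) L →+* LocalRing L v).toMonoidHom (t : ideleGroup L), unitsMap_adeleToLocal_mem_normOneUnits L t.2⟩ := by
  obtain ⟨h1, hsupp, -⟩ := IdeleHerbrand.mem_localUnitIdeles_iff.1 ht
  refine Subtype.ext ?_
  rw [coe_locTorusIncl]
  exact (semilocalUnits_unitsMap_adeleToLocal_of_supported L h1 hsupp).symm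

end Bookkeeping

/-! ## §2 Continuity into `ℂˣ`; the places over the ramified places are fixed by `c` -/

/-- a homomorphism into `ℂˣ` from a topological group is continuous as soon as it is continuous in `ℂ`. [folklore] -/
theorem continuous_of_continuous_coe {G : Type*} [Group G] [TopologicalSpace G] [ContinuousInv G] (χ : G →* ℂˣ)
    (hχ : Continuous fun g => ((χ g : ℂˣ) : ℂ)) : Continuous χ := by
  refine Units.continuous_iff.2 ⟨hχ, ?_⟩
  have h : (fun g => ((χ g : ℂˣ)⁻¹ : ℂˣ).val) = fun g => ((χ g⁻¹ : ℂˣ) : ℂ) := funext fun g => by rw [map_inv]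
  rw [h]
  exact hχ.comp continuous_inv

/-- **the places of `L` over a place of `L⁺` RAMIFIED in `L` are fixed by `c`** (there is exactly one, ★ `HeightOneSpectrum.eq_of_under_eq_of_not_isUnramifiedIn`; `c • u` lies over
the same place, ★ `HeightOneSpectrum.under_algEquiv_smul`). [cite: CasselsFrohlichANT1967, Ch. VII Prop. 1.2] -/
theorem smul_eq_of_not_isUnramifiedIn {w : HeightOneSpectrum (𝓞 ↥(maximalRealSubfield L))} (hram : ¬ Algebra.IsUnramifiedIn (𝓞 L) w.asIdeal) (u : PlacesOver L w) :
    IsCMField.complexConj L • u.1 = u.1 := by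
  have h2 : (Module.finrank ↥(maximalRealSubfield L) L).Prime := by
    rw [Algebra.IsQuadraticExtension.finrank_eq_two ↥(maximalRealSubfield L) L]; exact Nat.prime_two
  refine HeightOneSpectrum.eq_of_under_eq_of_not_isUnramifiedIn h2 ?_ ?_ hram
  · rw [← HeightOneSpectrum.under_asIdeal, HeightOneSpectrum.under_algEquiv_smul, u.2]
  · rw [← HeightOneSpectrum.under_asIdeal, u.2]

/-! ## §3 The assembly: prescribed component at `v`, trivial data at the ramified places, Weil's principle with prescribed components (★ §45.16) -/

/-- **L-C′ `TorusCharExtend`, HYPOTHESIS-FIRST ON THE COMPENSATING EXPONENTS.**  `L` CM, `v` a finite place of `L⁺` NON-SPLIT in `L`, `χT : T(L⁺_v) →* ℂˣ` continuous, and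
exponents `e : (w ∣ ∞) → ℤ` COMPENSATING `χT` on the roots of unity (`hζ : χT((ζ)_v) = ∏_w ι_w(ζ)^{e_w}` for every `ζ ∈ μ(L)`; R90-C138-p06's brick B3 produces such `e`).
Then there is an AUTOMORPHIC character `ψ` of `T(𝔸_{L⁺})` (★ `TorusDict.IsAutomorphic`) with
(i) `v`-component `χT` (★ `torusLocalComponent`), (ii) `ψ = 1` on `T(𝒪_w) = T(𝔸) ∩ ∏_{u∣w} 𝒪_u^×` (★ `localUnitIdeles L⁺ L w`) for EVERY finite `w ≠ v` — unramified AND ramified —,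
(iii) base change `χ̃ = ψ ∘ (z ↦ c z ∕ z)` of archimedean type `(2e, 0)`.  PROOF: ★ §45.16 `TorusDict.exists_isAutomorphic_of_localData` at `V :=` the places over `{v} ∪ Ram(L∕L⁺)`
with data `π_u := θ ∘ (·)_v ∘ ⟨·⟩_u`, `θ := (χT ∘ quotConj)⁻¹` (so `π_u = 1` off `v`), read back through local Hilbert 90 (★ `exists_quotConj_eq_of_nonsplit`, ★ `cm_pullback_semilocalComponent`).
[cite: Rogawski1990, §13.8 p. 217 l. 9–12] [cite: Arthur2013, §6.2 Lemma 6.2.2 and Remark 3] [cite: Weil1956, §1] -/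
theorem exists_isAutomorphic_torusLocalComponent_eq_spherical_off_of_exponents
    (v : HeightOneSpectrum (𝓞 ↥(maximalRealSubfield L))) (hns : ∀ w : PlacesOver L v, IsCMField.complexConj L • w.1 = w.1)
    (χT : ↥(normOneUnits (conjLocal L (IsCMField.complexConj L) v)) →* ℂˣ) (hχTc : Continuous fun t => ((χT t : ℂˣ) : ℂ))
    (e : InfinitePlace L → ℤ)
    (hζ : ∀ (ζ : Lˣ) (hζT : Units.map (adeleToLocal L v : AdeleRing (𝓞 L) L →+* LocalRing L v).toMonoidHom (GaloisRepresentations.principalIdele L ζ) ∈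
        normOneUnits (conjLocal L (IsCMField.complexConj L) v)), IsOfFinOrder ζ →
        ((χT ⟨_, hζT⟩ : ℂˣ) : ℂ) = ∏ w : InfinitePlace L, (w.embedding (ζ : L)) ^ (e w)) :
    ∃ (ψ : ↥(TorusDict.torus (IsCMField.complexConj L)) →ₜ* ℂˣ) (hψ : TorusDict.IsAutomorphic (IsCMField.complexConj L) ψ),
      torusLocalComponent L (IsCMField.complexConj L) v ψ = χT ∧
      (∀ w : HeightOneSpectrum (𝓞 ↥(maximalRealSubfield L)), w ≠ v →
        ∀ t : ↥(TorusDict.torus (IsCMField.complexConj L)), (t : ideleGroup L) ∈ IdeleHerbrand.localUnitIdeles ↥(maximalRealSubfield L) L w → ψ t = 1) ∧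
      (TorusDict.pullback (IsCMField.complexConj L) (Algebra.IsQuadraticExtension.finrank_eq_two ↥(maximalRealSubfield L) L) (IsCMField.complexConj_ne_one (K := L)) ψ hψ).HasUnitaryArchType
        (fun w => 2 * e w) (fun _ => 0) := by
  classical
  -- abbreviations
  have hc : IsCMField.complexConj L ≠ 1 := IsCMField.complexConj_ne_one (K := L)
  have h2 : Module.finrank ↥(maximalRealSubfield L) L = 2 := Algebra.IsQuadraticExtension.finrank_eq_two ↥(maximalRealSubfield L) L
  obtain ⟨w₀⟩ := (inferInstance : Nonempty (PlacesOver L v))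
  haveI hsub : Subsingleton (PlacesOver L v) := PlacesOver.subsingleton_of_smul_eq (IsCMField.complexConj L) hc w₀ (hns w₀)
  -- the character `θ := (χT ∘ quotConj)⁻¹` of `(L ⊗ L⁺_v)ˣ`
  obtain ⟨θ, hθ⟩ : ∃ θ : (LocalRing L v)ˣ →* ℂˣ, ∀ x, θ x = (χT (quotConj (conjLocal L (IsCMField.complexConj L) v) (conjLocal_conjLocal_cm L v) x))⁻¹ :=
    ⟨(χT.comp (quotConj (conjLocal L (IsCMField.complexConj L) v) (conjLocal_conjLocal_cm L v)))⁻¹, fun x => rfl⟩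
  have hqc : Continuous (quotConj (conjLocal L (IsCMField.complexConj L) v) (conjLocal_conjLocal_cm L v)) := by
    have hmap : Continuous (Units.map (conjLocal L (IsCMField.complexConj L) v : LocalRing L v →* LocalRing L v)) :=
      Continuous.units_map _ (continuous_conjLocal L (IsCMField.complexConj L) v)
    refine Continuous.subtype_mk ?_ _
    exact continuous_id.mul hmap.inv
  have hθc : Continuous fun x => ((θ x : ℂˣ) : ℂ) := by
    have h : (fun x => ((θ x : ℂˣ) : ℂ)) = fun x => ((χT (quotConj (conjLocal L (IsCMField.complexConj L) v) (conjLocal_conjLocal_cm L v) x⁻¹) : ℂˣ) : ℂ) :=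
      funext fun x => by rw [hθ, ← map_inv, ← map_inv]
    rw [h]
    exact hχTc.comp (hqc.comp continuous_inv)
  have hθu : ∀ x, ‖((θ x : ℂˣ) : ℂ)‖ = 1 := fun x => by
    rw [hθ, Units.val_inv_eq_inv_val, norm_inv, Cruxes.H413.F0P3cStCharTSPrincipalSeriesUnitary.norm_apply_normOneUnits_eq_one L v hns χT hχTc, inv_one]
  -- the local data `π u := θ ∘ (·)_v ∘ ⟨·⟩_u`
  obtain ⟨π, hπ⟩ : ∃ π : (u : HeightOneSpectrum (𝓞 L)) → ((u.adicCompletion L)ˣ →* ℂˣ),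
      ∀ u x, π u x = θ (Units.map (adeleToLocal L v : AdeleRing (𝓞 L) L →+* LocalRing L v).toMonoidHom (localUnits u x)) :=
    ⟨fun u => θ.comp ((Units.map (adeleToLocal L v : AdeleRing (𝓞 L) L →+* LocalRing L v).toMonoidHom).comp (localUnits u)), fun u x => rfl⟩
  have hπ_off : ∀ u : HeightOneSpectrum (𝓞 L), u.under (𝓞 ↥(maximalRealSubfield L)) ≠ v → ∀ x, π u x = 1 := fun u hu x => by
    rw [hπ, unitsMap_adeleToLocal_localUnits_of_under_ne L hu, map_one]
  have hπc : ∀ u, Continuous (π u) := fun u => by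
    refine continuous_of_continuous_coe (π u) ?_
    have h : (fun x => ((π u x : ℂˣ) : ℂ)) = fun x => ((θ (Units.map (adeleToLocal L v : AdeleRing (𝓞 L) L →+* LocalRing L v).toMonoidHom (localUnits u x)) : ℂˣ) : ℂ) :=
      funext fun x => by rw [hπ]
    rw [h]
    exact hθc.comp ((continuous_unitsMap_adeleToLocal L).comp (continuous_localUnits u))
  have hπu : ∀ u x, ‖((π u x : ℂˣ) : ℂ)‖ = 1 := fun u x => by rw [hπ]; exact hθu _
  -- the set of prescribed places: over `v` and over the ramified places
  obtain ⟨S, hSv, hSram, hS⟩ : ∃ S : Finset (HeightOneSpectrum (𝓞 ↥(maximalRealSubfield L))), v ∈ S ∧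
      (∀ w, ¬ Algebra.IsUnramifiedIn (𝓞 L) w.asIdeal → w ∈ S) ∧ ∀ w ∈ S, w = v ∨ ¬ Algebra.IsUnramifiedIn (𝓞 L) w.asIdeal := by
    refine ⟨insert v (GaloisRepresentations.finite_setOf_not_isUnramifiedIn ↥(maximalRealSubfield L) L).toFinset, Finset.mem_insert_self _ _,
      fun w hw => Finset.mem_insert_of_mem ((Set.Finite.mem_toFinset _).2 hw), fun w hw => ?_⟩
    rcases Finset.mem_insert.1 hw with h | h
    · exact Or.inl h
    · exact Or.inr ((Set.Finite.mem_toFinset _).1 h)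
  let V : Finset (HeightOneSpectrum (𝓞 L)) := S.biUnion fun w => (Finset.univ : Finset (PlacesOver L w)).map ⟨Subtype.val, Subtype.val_injective⟩
  have hVmem : ∀ u : HeightOneSpectrum (𝓞 L), u ∈ V ↔ u.under (𝓞 ↥(maximalRealSubfield L)) ∈ S := fun u => by
    simp only [V, Finset.mem_biUnion, Finset.mem_map, Finset.mem_univ, true_and, Function.Embedding.coeFn_mk]
    constructor
    · rintro ⟨w, hw, u', rfl⟩
      rw [u'.2]; exact hw
    · intro hu
      exact ⟨_, hu, ⟨u, rfl⟩, rfl⟩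
  have hw₀V : w₀.1 ∈ V := (hVmem _).2 (by rw [w₀.2]; exact hSv)
  -- every place of `V` is fixed by `c`
  have hV : ∀ u ∈ V, IsCMField.complexConj L • u = u := fun u hu => by
    rcases hS _ ((hVmem u).1 hu) with h | h
    · exact hns ⟨u, h⟩
    · exact smul_eq_of_not_isUnramifiedIn L h ⟨u, rfl⟩
  -- the data are trivial on `(𝕀_{L⁺})_L`
  have hπF : ∀ u ∈ V, ∀ a : ideleGroup ↥(maximalRealSubfield L), π u (TorusDict.cpt u (AdeleRing.ideleBaseChange ↥(maximalRealSubfield L) L a)) = 1 := by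
    intro u hu a
    by_cases huv : u.under (𝓞 ↥(maximalRealSubfield L)) = v
    · rw [hπ, unitsMap_adeleToLocal_localUnits_cpt L ⟨u, huv⟩ (hns ⟨u, huv⟩), hθ, quotConj_eq_one_of_fixed L (unitsMap_conjLocal_unitsMap_adeleToLocal_ideleBaseChange L a),
        map_one, inv_one]
    · exact hπ_off u huv _
  -- the joint condition on `μ(L)`
  have H : ∀ k : Lˣ, IsOfFinOrder (k * (Units.map ((IsCMField.complexConj L : L ≃ₐ[↥(maximalRealSubfield L)] L) : L →+* L).toMonoidHom k)⁻¹) →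
      (∏ w : InfinitePlace L, (w.embedding ((k : L) * (IsCMField.complexConj L (k : L))⁻¹)) ^ (e w)) *
        (∏ u ∈ V, ((π u (TorusDict.cpt u (GaloisRepresentations.principalIdele L k)) : ℂˣ) : ℂ)) = 1 := by
    intro k hfin
    -- only the place over `v` contributes
    rw [Finset.prod_eq_single_of_mem w₀.1 hw₀V fun u hu hne => ?_]
    swap
    · have huv : u.under (𝓞 ↥(maximalRealSubfield L)) ≠ v := fun h => hne (congrArg Subtype.val (PlacesOver.eq_of_smul_eq (IsCMField.complexConj L) hc w₀ (hns w₀) ⟨u, h⟩))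
      rw [hπ_off u huv, Units.val_one]
    -- the value at the place over `v` is `χT((k ∕ c k)_v)⁻¹`
    obtain ⟨n, hn, hkn⟩ := isOfFinOrder_iff_pow_eq_one.mp hfin
    have hmemT : GaloisRepresentations.principalIdele L (k * (Units.map ((IsCMField.complexConj L : L ≃ₐ[↥(maximalRealSubfield L)] L) : L →+* L).toMonoidHom k)⁻¹) ∈
        TorusDict.torus (IsCMField.complexConj L) :=
      TorusDict.principalIdele_mem_torus_of_pow_eq_one (IsCMField.complexConj L) h2 hc inferInstance inferInstance hn.ne' hkn
    have hmem := unitsMap_adeleToLocal_mem_normOneUnits L (v := v) hmemT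
    have hq : quotConj (conjLocal L (IsCMField.complexConj L) v) (conjLocal_conjLocal_cm L v)
        (Units.map (adeleToLocal L v : AdeleRing (𝓞 L) L →+* LocalRing L v).toMonoidHom (GaloisRepresentations.principalIdele L k)) = ⟨_, hmem⟩ :=
      Subtype.ext (coe_quotConj_unitsMap_adeleToLocal_principalIdele L k)
    have hval : ((k * (Units.map ((IsCMField.complexConj L : L ≃ₐ[↥(maximalRealSubfield L)] L) : L →+* L).toMonoidHom k)⁻¹ : Lˣ) : L) =
        (k : L) * (IsCMField.complexConj L (k : L))⁻¹ := by
      rw [Units.val_mul, Units.val_inv_eq_inv_val, Units.coe_map]; rfl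
    rw [hπ, unitsMap_adeleToLocal_localUnits_cpt L w₀ (hns w₀), hθ, hq, Units.val_inv_eq_inv_val, hζ _ hmem hfin, hval,
      mul_inv_cancel₀]
    rw [← hval, ← hζ _ hmem hfin]
    exact Units.ne_zero _
  -- ★ Weil's principle with prescribed components
  obtain ⟨ψ, hψ, -, hloc, harch, -, hsph⟩ := TorusDict.exists_isAutomorphic_of_localData (IsCMField.complexConj L) h2 hc inferInstance inferInstance e hV π
    (fun u _ => hπc u) (fun u _ x => hπu u x) hπF H
  refine ⟨ψ, hψ, ?_, ?_, harch⟩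
  · -- (i) the `v`-component: `χ̃_v(x) = ξ_v(x ∕ x̄)⁻¹` and `χ̃_{w₀} = π_{w₀} = θ ∘ (·)_v ∘ ⟨·⟩_{w₀}`
    refine MonoidHom.ext fun β => ?_
    obtain ⟨x, rfl⟩ := exists_quotConj_eq_of_nonsplit L v hns β
    have h1 := cm_pullback_semilocalComponent L ψ hψ x
    rw [semilocalComponent_eq_localComponent_of_smul_eq L (IsCMField.complexConj L) hc w₀ (hns w₀), hloc w₀.1 hw₀V, hπ] at h1
    -- `semilocalUnits v x = ⟨x_{w₀}⟩_{w₀}` at a non-split `v`, so `((⟨x_{w₀}⟩_{w₀})_v) = x`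
    have hsl : semilocalUnits L v x = localUnits w₀.1 (MulEquiv.piUnits x w₀) := by
      rw [semilocalUnits_apply, PlacesOver.prod_eq_of_smul_eq (IsCMField.complexConj L) hc w₀ (hns w₀)]
    have hx : Units.map (adeleToLocal L v : AdeleRing (𝓞 L) L →+* LocalRing L v).toMonoidHom (localUnits w₀.1 (MulEquiv.piUnits x w₀)) = x := by
      rw [← hsl, map_adeleToLocal_semilocalUnits]
    rw [hx, hθ] at h1
    exact (inv_injective h1).symm
  · -- (ii) sphericity at every finite `w ≠ v`
    intro w hwv t ht
    by_cases hram : Algebra.IsUnramifiedIn (𝓞 L) w.asIdeal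
    · -- unramified in `L`: ★'s sphericity clause (`w` is not below `V`)
      refine hsph w hram (fun u hu huw => ?_) t ht
      rcases hS _ ((hVmem u).1 hu) with h | h
      · exact hwv (huw.symm.trans h)
      · exact h (huw ▸ hram)
    · -- ramified in `L`: `w` is non-split, its place `u_w ∈ V` carries the TRIVIAL datum, so `ψ_w ≡ 1` by local Hilbert 90
      obtain ⟨uw⟩ := (inferInstance : Nonempty (PlacesOver L w))
      have hnsw : ∀ u : PlacesOver L w, IsCMField.complexConj L • u.1 = u.1 := smul_eq_of_not_isUnramifiedIn L hram
      have huwV : uw.1 ∈ V := (hVmem _).2 (by rw [uw.2]; exact hSram w hram)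
      rw [eq_locTorusIncl_of_mem_localUnitIdeles L ht]
      obtain ⟨x, hx⟩ := exists_quotConj_eq_of_nonsplit L w hnsw
        ⟨Units.map (adeleToLocal L w : AdeleRing (𝓞 L) L →+* LocalRing L w).toMonoidHom (t : ideleGroup L), unitsMap_adeleToLocal_mem_normOneUnits L t.2⟩
      have h1 := cm_pullback_semilocalComponent L ψ hψ x
      rw [semilocalComponent_eq_localComponent_of_smul_eq L (IsCMField.complexConj L) hc uw (hnsw uw), hloc uw.1 huwV,
        hπ_off uw.1 (by rw [uw.2]; exact hwv), hx] at h1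
      rw [← torusLocalComponent_apply]
      exact inv_eq_one.1 h1.symm

end Summit.HodgeConjecture.HodgeConjecture.R90.S10

end
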